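import Mathlib
import Literature.Probability.LatticeModels.CollarLegModel
import Literature.Probability.LatticeModels.DirichletGreenFunction
import Literature.Probability.LatticeModels.DomainDiscretisation
import Literature.Probability.LatticeModels.LatticeGraph
import Literature.Probability.RandomPlanarGeometry.PlanarDomains
import HarnessLib

/-!
# FlatBoundaryPoissonKernelLimit

Topic `Literature/Probability/LatticeModels`. Named literature fact(s) relocated by the gate from `Summits/CriticalPhenomena/CardyFormulaZ2/Theorems/CardyBoundaryCoulombGasBoundaryDefectGaussianRStubGreenKernelAsymptoticsPart5.lean`
(accept-time relocation of `[cite]`d propositions written inline in a Summits proposal; human ruling 2026-08-15).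
Sources: ChelkakSmirnov2011, Kenyon2000.

* `Literature.Probability.LatticeModels.ChelkakSmirnov2011_boundaryNormalisedPoissonKernelLimit`
* `Literature.Probability.LatticeModels.Kenyon2000_flatEdgePoissonKernelLimit`
-/

namespace Literature.Probability.LatticeModels

open Filter Topology Set Metric
open Literature.Probability.RandomPlanarGeometry Literature.Probability.LatticeModels

/-- **Kenyon 2000 — the rescaled Dirichlet Green function with one argument on a flat boundary
edge converges to the Poisson kernel** (named fact, not proved in the tree; specialised form).
R. Kenyon, *Conformal invariance of domino tiling*, Ann. Probab. 28 (2000), no. 2, §5.3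
(arXiv:math-ph/9910002). Setting: `U ⊂ ℂ` a region with piecewise smooth boundary, `P_ε ⊂ εℤ²`
Temperleyan polyominoes approximating `U` (boundaries within `O(ε)`, parallel edge directions away
from corners), `G(v₁,v₂)` the Green's function of the graph `B₀'(P_ε)` (the black squares of type
`B₀`, a square lattice of spacing `2ε`, with `Δ = 4 − A` and Dirichlet condition on the boundary
vertices `Y`; for simply connected `U` this is the present tree's `dirichletGreen` of the vertex set
`B₀(P_ε)`), `g_U` the Green's function of `U` (`Δ g_U(z₁,·) = δ_{z₁}`, `Δ = −∂²_x − ∂²_y`).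
Lemma 17: for `z₁` interior and `v₁ → z₁`, `v₂ → z₂ ≠ z₁`, "the difference of (rescaled) Green's
functions `ε⁻¹G(v₁+ε,v₂) − ε⁻¹G(v₁−ε,v₂)` converges to `2∂_{x₁} g_U(z₁,z₂)`". Corollary 19: "If `z₁`
is on the boundary of `U`, and the boundary of both `U` and `P_ε` is straight and horizontal in a
`δ`-neighborhood of `z₁`, then for `v₁` within `O(ε)` of `z₁`, `ε⁻¹G(v₁,v₂)`" converges (printed
"`= g_U(z₁,z₂) + o(1)`", `g_U(z₁,·)` standing there for the boundary limit function; "A similar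
result holds when the boundary is vertical"); its proof — odd reflection of `B₀'(P_ε)` across the
boundary row, which turns `G(v₁,·)` into the dipole `G'(v₁,·) − G'(v₁*,·)` of Lemma 17 in the
normal direction (`G'` the Green's function of the reflected-and-glued graph, `v₁*` the mirror image
of `v₁`) — identifies the limit for `v₁` on the lattice row adjacent to the Dirichlet row as the
inner normal derivative of `g_U` per lattice spacing: `G(v₁,v₂)/(2ε) → ∂_{n(z₁)} g_U(z₁,z₂)`, the
Poisson kernel density of `U` at `z₁` seen from `z₂` (in the half-plane `(1/π) Im z₂/|z₂ − z₁|²`).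
SPECIAL CASE STATED HERE: `U = D` a rectilinear Jordan domain (finitely many axis-parallel sides),
`z₁ = x` a flat boundary point, lattice `δ_n ℤ²` with `V_n = {v : δ_n v ∈ D̄}` (its even polyomino
approximates `D` within `O(δ_n)` with parallel sides), `v₁ = a_n ∈ V_n` with exactly one lattice
neighbour outside `V_n` (i.e. on the boundary row of the flat edge) and `δ_n a_n → x`,
`v₂ = c_n ∈ V_n` with `δ_n c_n → u ∈ D`; the Poisson kernel of `D` is written through any conformal
bijection `w : D → ℍ` holomorphic near `x` (conformal covariance, density w.r.t. arc length):
`P_D(u; x) = (1/π) Im w(u) |w′(x)| / |w(u) − w(x)|²`. Conclusion: `G_{V_n}(c_n,a_n)/δ_n → P_D(u;x)`.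
TODO(general form): piecewise smooth `U`, general Temperleyan approximations, multiply connected
`U`, and the interior dipole statement (Lemma 17) itself.
[cite: Kenyon2000, Cor. 19] [file Probability/LatticeModels/FlatBoundaryPoissonKernelLimit] -/
def Kenyon2000_flatEdgePoissonKernelLimit : Prop :=
  ∀ (D : Literature.Probability.RandomPlanarGeometry.JordanDomain), (∃ S : Finset (ℂ × ℂ), (∀ q ∈ S, q.1.re = q.2.re ∨ q.1.im = q.2.im) ∧
      frontier D.carrier ⊆ ⋃ q ∈ S, segment ℝ q.1 q.2) →
    ∀ (x : ℂ), x ∈ frontier D.carrier →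
    (∃ r : ℝ, 0 < r ∧ ((∀ z ∈ frontier D.carrier, dist z x < r → z.im = x.im) ∨
      (∀ z ∈ frontier D.carrier, dist z x < r → z.re = x.re))) →
    ∀ (w : ℂ → ℂ) (U : Set ℂ), IsOpen U → D.carrier ⊆ U → x ∈ U → DifferentiableOn ℂ w U →
      Set.BijOn w D.carrier {z : ℂ | 0 < z.im} →
    ∀ (δ : ℕ → ℝ), (∀ n, 0 < δ n) → Filter.Tendsto δ Filter.atTop (nhds 0) →
    ∀ (V : ℕ → Finset (Literature.Probability.LatticeModels.Site 2)), (∀ n v, v ∈ V n ↔ Literature.Probability.LatticeModels.meshPoint (δ n) v ∈ closure D.carrier) →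
    ∀ (a : ℕ → Literature.Probability.LatticeModels.Site 2),
      (∀ n, a n ∈ V n ∧ (((Literature.Probability.LatticeModels.zdGraph 2).neighborFinset (a n)).filter (fun u => u ∉ V n)).card = 1) →
      Filter.Tendsto (fun n => Literature.Probability.LatticeModels.meshPoint (δ n) (a n)) Filter.atTop (nhds x) →
    ∀ (u : ℂ), u ∈ D.carrier → ∀ (c : ℕ → Literature.Probability.LatticeModels.Site 2), (∀ n, c n ∈ V n) →
      Filter.Tendsto (fun n => Literature.Probability.LatticeModels.meshPoint (δ n) (c n)) Filter.atTop (nhds u) →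
    Filter.Tendsto (fun n => Literature.Probability.LatticeModels.dirichletGreen (V n) (c n) (a n) / δ n)
      Filter.atTop (nhds (1 / Real.pi * ((w u).im * ‖deriv w x‖ / ‖w u - w x‖ ^ 2)))

/-- **Chelkak–Smirnov 2011, Theorem 3.13 — convergence of the discrete Poisson kernel normalised
at a straight boundary point** (named fact, not proved in the tree; specialised to `ℤ²`).
D. Chelkak, S. Smirnov, *Discrete complex analysis on isoradial graphs*, Adv. Math. 228 (2011)
1590–1630 (arXiv:0810.2188), §3.5. Setting: simply connected discrete domains `Ω^δ_Γ` on
isoradial graphs of mesh `δ` with `R^δ_Γ(S,T) ⊆ Ω^δ_Γ`, `L^δ_Γ(S) ⊆ ∂Ω^δ_Γ` (a discrete rectangle on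
a straight part of the boundary) and a boundary vertex `a^δ ∉ L^δ_Γ(S)` (the pole); `o^δ` the
boundary vertex of `L^δ_Γ(S)` closest to `0`, `o^δ_int` its interior neighbour; the discrete Poisson
kernel normalised at `o^δ` is
`P^δ_{o^δ}(·; a^δ; Ω^δ_Γ) = ω^δ(·; a^δ; Ω^δ_Γ) · ĝ^δ(o^δ_int) / ω^δ(o^δ_int; a^δ; Ω^δ_Γ)`, with
`ω^δ(·; a^δ; Ω^δ_Γ)` the harmonic measure of the boundary vertex `a^δ` (exit through the edge
`a^δ_int a^δ`) and `ĝ^δ` the discrete harmonic "imaginary part" of the discrete half-plane (on `ℤ²`: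
mesh times the lattice distance to the killed row); in the continuum `P_0(·; a; Ω)` is "the
(unique) solution of `ΔP_0 = 0` in `Ω`, `P_0 = 0` on `∂Ω ∖ {a}`, `P_0 ≥ 0` and `∂_y P_0(0) = 1`".
Theorem 3.13: "The discrete Poisson kernels `P^δ_{o^δ}(·; a^δ; Ω^δ_Γ)` defined for the class of
discrete domains satisfying [`R^δ_Γ(S,T) ⊆ Ω^δ_Γ`, `L^δ_Γ(S) ⊆ ∂Ω^δ_Γ`, `a^δ ∉ L^δ_Γ(S)`] with some `S, T > 0` are uniformly `C¹`-close in `Ω̃^δ` to the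
continuous Poisson kernels `P_0(·; a^δ; Ω̃^δ)`"; the proof establishes the pointwise form
`P^δ_{o^δ}(u^δ; a^δ; Ω^δ_Γ) → P_0(u; a; Ω)` along Carathéodory-convergent
`(Ω^δ; u^δ; a^δ) → (Ω; u; a)`. SPECIAL CASE STATED HERE: `Γ = δ_n ℤ²` (isoradial, `θ ≡ π/4`),
`Ω^δ_Γ =` the lattice approximation `V_n = {v : δ_n v ∈ D̄}` of a rectilinear Jordan domain `D`,
`o^δ_int = a_n ∈ V_n` a point with exactly one lattice neighbour outside `V_n` converging to a flat
boundary point `x` (`δ_n a_n → x`), pole = the outer vertex across the edge at such a point `b_n`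
with `δ_n b_n → y ≠ x` (`y` flat), so that `ω^δ(z; pole) = G_{V_n}(z, b_n)`
(`G = dirichletGreen = (4 − A)⁻¹`, exit through the edge at `b_n`) and `ĝ^δ(a_n) = δ_n`; evaluation
at `u^δ = c_n ∈ V_n` with `δ_n c_n → u ∈ D`; and `P_0(·; y; D)` normalised at `x`, written through any
conformal bijection `w : D → ℍ` holomorphic near `x` and `y` (the conformal image of
`Im z/|z − w(y)|²`, whose inner normal derivative at `x` is `|w′(x)|/|w(x) − w(y)|²`):
`P_0(u) = [Im w(u)/|w(u) − w(y)|²]·[|w(x) − w(y)|²/|w′(x)|]`. Conclusion: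
`G_{V_n}(c_n,b_n) δ_n / G_{V_n}(a_n,b_n) → P_0(u)`.
TODO(general form): isoradial graphs, arbitrary simply connected discrete domains with a
straight boundary part, uniform `C¹`-closeness of values and discrete gradients on compacts,
Carathéodory convergence with marked prime ends.
[cite: ChelkakSmirnov2011, Thm. 3.13] [file Probability/LatticeModels/FlatBoundaryPoissonKernelLimit] -/
def ChelkakSmirnov2011_boundaryNormalisedPoissonKernelLimit : Prop :=
  ∀ (D : Literature.Probability.RandomPlanarGeometry.JordanDomain), (∃ S : Finset (ℂ × ℂ), (∀ q ∈ S, q.1.re = q.2.re ∨ q.1.im = q.2.im) ∧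
      frontier D.carrier ⊆ ⋃ q ∈ S, segment ℝ q.1 q.2) →
    ∀ (x y : ℂ), x ∈ frontier D.carrier → y ∈ frontier D.carrier → x ≠ y →
    (∃ r : ℝ, 0 < r ∧ ((∀ z ∈ frontier D.carrier, dist z x < r → z.im = x.im) ∨
      (∀ z ∈ frontier D.carrier, dist z x < r → z.re = x.re))) →
    (∃ r : ℝ, 0 < r ∧ ((∀ z ∈ frontier D.carrier, dist z y < r → z.im = y.im) ∨
      (∀ z ∈ frontier D.carrier, dist z y < r → z.re = y.re))) →
    ∀ (w : ℂ → ℂ) (U : Set ℂ), IsOpen U → D.carrier ⊆ U → x ∈ U → y ∈ U →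
      DifferentiableOn ℂ w U → Set.BijOn w D.carrier {z : ℂ | 0 < z.im} →
    ∀ (δ : ℕ → ℝ), (∀ n, 0 < δ n) → Filter.Tendsto δ Filter.atTop (nhds 0) →
    ∀ (V : ℕ → Finset (Literature.Probability.LatticeModels.Site 2)), (∀ n v, v ∈ V n ↔ Literature.Probability.LatticeModels.meshPoint (δ n) v ∈ closure D.carrier) →
    ∀ (a b : ℕ → Literature.Probability.LatticeModels.Site 2),
      (∀ n, a n ∈ V n ∧ (((Literature.Probability.LatticeModels.zdGraph 2).neighborFinset (a n)).filter (fun u => u ∉ V n)).card = 1) →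
      (∀ n, b n ∈ V n ∧ (((Literature.Probability.LatticeModels.zdGraph 2).neighborFinset (b n)).filter (fun u => u ∉ V n)).card = 1) →
      Filter.Tendsto (fun n => Literature.Probability.LatticeModels.meshPoint (δ n) (a n)) Filter.atTop (nhds x) →
      Filter.Tendsto (fun n => Literature.Probability.LatticeModels.meshPoint (δ n) (b n)) Filter.atTop (nhds y) →
    ∀ (u : ℂ), u ∈ D.carrier → ∀ (c : ℕ → Literature.Probability.LatticeModels.Site 2), (∀ n, c n ∈ V n) →
      Filter.Tendsto (fun n => Literature.Probability.LatticeModels.meshPoint (δ n) (c n)) Filter.atTop (nhds u) →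
    Filter.Tendsto (fun n => Literature.Probability.LatticeModels.dirichletGreen (V n) (c n) (b n) * δ n /
        Literature.Probability.LatticeModels.dirichletGreen (V n) (a n) (b n)) Filter.atTop
      (nhds ((w u).im / ‖w u - w y‖ ^ 2 * (‖w x - w y‖ ^ 2 / ‖deriv w x‖)))

/-! ### Interior lattice points -/

end Literature.Probability.LatticeModels
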